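import Summits.CriticalPhenomena.PercolationContinuityZ3.Theorems.PercNearOneGluingNoHeavyLowerTailQ7PsiOfCov
import HarnessLib

/-!
# `NoHeavyLowerTail` (stmt-CriticalPhenomena-4575) — the MAX-ROBUST form of the (GΨ₃) certificate: socket

Support file (lemma factory `prim-lf-3` gen 15; `--supports stmt-CriticalPhenomena-4575`).  No definitions, no named facts, no sorries.
Memo: `run/shared/lean/prim/prim-lf-3/LF3-BETA-R.md` §18g–h.

The coupling seat's certificate `Ψ ≥ λ·Dx + μ·Dy` (observer part (O*) and weak-relay part (Z*), `Q7Psi.gpsi_three_robust_of_dom`) gives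
the SUM-robust inequality `min(Dx,0) + min(Dy,0) ≤ Ψ` from `0 ≤ λ, μ ≤ 1`.  THIS FILE records the one-line MAX-robust variant: if moreover
`λ + μ ≤ 1` then `min(min(Dx, Dy), 0) ≤ Ψ` (`gpsi_three_maxRobust_of_dom`).  With the closed-form multipliers
`λ* = (a + t*d)/μ(x↮z)`, `μ* = (b + (1−t*)d)/μ(y↮z)` of `Q7Psi.gpsi_three_robust_of_cov` the extra hypothesis `λ* + μ* ≤ 1` holds in every
censused instance (memo §18h: 700 random graphs + adversarial climbs, infimum of `1 − λ* − μ*` = 0 at the glued locus; equivalent to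
`a·e2·[(Ay−b)(Ax−a−d) − b(a+d)] + b·e1·[(Ax−a)(Ay−b−d) − a(b+d)] ≥ 0`, whose two brackets fail separately); the max-robust (GΨ₃) is the
vertex (`|S| = 1`) case of the last open atom of the `2 + m` programme (MRΨ-glued / CLUB, memo §18g).
[cite: KozmaNitzan2024, Question 7 (p. 36), §5.1 (pp. 31–32)]
-/

namespace Summit.CriticalPhenomena.PercolationContinuityZ3.Theorems

open MeasureTheory Set Literature.Probability.LatticeModels Literature.Probability.Percolation
open scoped Classical
open KNPreFKG BHK2006

noncomputable section

namespace Q7Psi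

universe u

variable {V : Type u} [Fintype V]

/-- **The max-robust form of the certificate** (socket): if (O*) and (Z*) hold with multipliers `λ, μ ≥ 0`, `λ + μ ≤ 1`, then with
`J = o↔x ∪ o↔y`, `Dx = ∫ F(C x) − ∫ F(C z)`, `Dy = ∫ F(C y) − ∫ F(C z)`:  `min(min(Dx, Dy), 0) ≤ ∫_J F(C o) − ∫_J F(C z)`.
[cite: KozmaNitzan2024, §5.1 (pp. 31–32), Question 7 (p. 36)] -/
theorem gpsi_three_maxRobust_of_dom (w : Sym2 V → unitInterval) (o x y z : V) (F : Set V → ℝ) (lam mu : ℝ)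
    (hlam : 0 ≤ lam) (hmu : 0 ≤ mu) (hsum : lam + mu ≤ 1)
    (hO : lam * (∫ ω in {ω : BondConfig V | ¬ (openGraph ω).Reachable x z}, F (openCluster ω x) ∂(prodBernoulli w)) +
        mu * (∫ ω in {ω : BondConfig V | ¬ (openGraph ω).Reachable y z}, F (openCluster ω y) ∂(prodBernoulli w)) ≤
      ∫ ω in (openConn o x ∪ openConn o y) ∩ {ω | ¬ (openGraph ω).Reachable o z},
        F (openCluster ω o) ∂(prodBernoulli w))
    (hZ : ∫ ω in (openConn o x ∪ openConn o y) ∩ {ω | ¬ (openGraph ω).Reachable o z},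
        F (openCluster ω z) ∂(prodBernoulli w) ≤
      lam * (∫ ω in {ω : BondConfig V | ¬ (openGraph ω).Reachable x z}, F (openCluster ω z) ∂(prodBernoulli w)) +
        mu * (∫ ω in {ω : BondConfig V | ¬ (openGraph ω).Reachable y z}, F (openCluster ω z) ∂(prodBernoulli w))) :
    min (min ((∫ ω, F (openCluster ω x) ∂(prodBernoulli w)) - ∫ ω, F (openCluster ω z) ∂(prodBernoulli w))
          ((∫ ω, F (openCluster ω y) ∂(prodBernoulli w)) - ∫ ω, F (openCluster ω z) ∂(prodBernoulli w))) 0 ≤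
      (∫ ω in (openConn o x ∪ openConn o y), F (openCluster ω o) ∂(prodBernoulli w)) -
        ∫ ω in (openConn o x ∪ openConn o y), F (openCluster ω z) ∂(prodBernoulli w) := by
  classical
  set μ := prodBernoulli w with hμ
  set J : Set (BondConfig V) := openConn o x ∪ openConn o y with hJ
  set Doz : Set (BondConfig V) := {ω | ¬ (openGraph ω).Reachable o z} with hDoz
  set Dxz : Set (BondConfig V) := {ω | ¬ (openGraph ω).Reachable x z} with hDxz
  set Dyz : Set (BondConfig V) := {ω | ¬ (openGraph ω).Reachable y z} with hDyz
  have hmeas : ∀ S : Set (BondConfig V), MeasurableSet S := fun _ => MeasurableSet.of_discrete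
  have hint : ∀ (g : BondConfig V → ℝ) (S : Set (BondConfig V)), IntegrableOn g S μ :=
    fun g S => (Integrable.of_finite).integrableOn
  -- `Dx`, `Dy` live on `D_xz`, `D_yz`
  have hx' : (∫ ω, F (openCluster ω x) ∂μ) - ∫ ω, F (openCluster ω z) ∂μ =
      (∫ ω in Dxz, F (openCluster ω x) ∂μ) - ∫ ω in Dxz, F (openCluster ω z) ∂μ := by
    have ex := integral_add_compl (hmeas Dxz) (Integrable.of_finite : Integrable (fun ω => F (openCluster ω x)) μ)
    have ez := integral_add_compl (hmeas Dxz) (Integrable.of_finite : Integrable (fun ω => F (openCluster ω z)) μ)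
    have ec : ∫ ω in Dxzᶜ, F (openCluster ω z) ∂μ = ∫ ω in Dxzᶜ, F (openCluster ω x) ∂μ := by
      refine setIntegral_congr_fun (hmeas Dxz).compl fun ω hω => ?_
      have hr : (openGraph ω).Reachable x z := by
        by_contra hc
        exact hω hc
      rw [openCluster_eq_of_reachable hr]
    linarith
  have hy' : (∫ ω, F (openCluster ω y) ∂μ) - ∫ ω, F (openCluster ω z) ∂μ =
      (∫ ω in Dyz, F (openCluster ω y) ∂μ) - ∫ ω in Dyz, F (openCluster ω z) ∂μ := by
    have ey := integral_add_compl (hmeas Dyz) (Integrable.of_finite : Integrable (fun ω => F (openCluster ω y)) μ)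
    have ez := integral_add_compl (hmeas Dyz) (Integrable.of_finite : Integrable (fun ω => F (openCluster ω z)) μ)
    have ec : ∫ ω in Dyzᶜ, F (openCluster ω z) ∂μ = ∫ ω in Dyzᶜ, F (openCluster ω y) ∂μ := by
      refine setIntegral_congr_fun (hmeas Dyz).compl fun ω hω => ?_
      have hr : (openGraph ω).Reachable y z := by
        by_contra hc
        exact hω hc
      rw [openCluster_eq_of_reachable hr]
    linarith
  -- `λ·Dx + μ·Dy ≥ min(min(Dx, Dy), 0)` for `λ, μ ≥ 0`, `λ + μ ≤ 1`
  have hmin : min (min ((∫ ω in Dxz, F (openCluster ω x) ∂μ) - ∫ ω in Dxz, F (openCluster ω z) ∂μ)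
        ((∫ ω in Dyz, F (openCluster ω y) ∂μ) - ∫ ω in Dyz, F (openCluster ω z) ∂μ)) 0 ≤
      lam * ((∫ ω in Dxz, F (openCluster ω x) ∂μ) - ∫ ω in Dxz, F (openCluster ω z) ∂μ) +
        mu * ((∫ ω in Dyz, F (openCluster ω y) ∂μ) - ∫ ω in Dyz, F (openCluster ω z) ∂μ) := by
    set a := (∫ ω in Dxz, F (openCluster ω x) ∂μ) - ∫ ω in Dxz, F (openCluster ω z) ∂μ
    set a' := (∫ ω in Dyz, F (openCluster ω y) ∂μ) - ∫ ω in Dyz, F (openCluster ω z) ∂μ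
    set m := min (min a a') 0 with hm
    have hma : m ≤ a := (min_le_left _ _).trans (min_le_left _ _)
    have hma' : m ≤ a' := (min_le_left _ _).trans (min_le_right _ _)
    have hm0 : m ≤ 0 := min_le_right _ _
    have h1 : lam * m ≤ lam * a := mul_le_mul_of_nonneg_left hma hlam
    have h2 : mu * m ≤ mu * a' := mul_le_mul_of_nonneg_left hma' hmu
    have h3 : m ≤ (lam + mu) * m := by nlinarith
    linarith
  -- from `J'` to `J`: on `J \ Doz` the clusters of `o` and `z` coincide
  have hc : ∫ ω in J \ Doz, F (openCluster ω z) ∂μ = ∫ ω in J \ Doz, F (openCluster ω o) ∂μ := by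
    refine setIntegral_congr_fun ((hmeas J).diff (hmeas Doz)) fun ω hω => ?_
    have hr : (openGraph ω).Reachable o z := by
      by_contra hc
      exact hω.2 hc
    rw [openCluster_eq_of_reachable hr]
  rw [hx', hy', ← integral_inter_add_sdiff (hmeas Doz) (hint _ J), ← integral_inter_add_sdiff (hmeas Doz) (hint _ J),
    hc]
  have hO' : lam * (∫ ω in Dxz, F (openCluster ω x) ∂μ) + mu * (∫ ω in Dyz, F (openCluster ω y) ∂μ) ≤
      ∫ ω in J ∩ Doz, F (openCluster ω o) ∂μ := hO
  have hZ' : ∫ ω in J ∩ Doz, F (openCluster ω z) ∂μ ≤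
      lam * (∫ ω in Dxz, F (openCluster ω z) ∂μ) + mu * (∫ ω in Dyz, F (openCluster ω z) ∂μ) := hZ
  linarith


end Q7Psi

end

end Summit.CriticalPhenomena.PercolationContinuityZ3.Theorems
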